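import Summits.AtomisticToContinuum.BoseEinsteinCondensation.Theorems.BECCellInformationEnergyPerParticleBound
import Summits.AtomisticToContinuum.BoseEinsteinCondensation.Theorems.BECCellInformationOneBodyEntropyBoundPosCoreOccupation

/-!
# Crux `OneBodyEntropyBound` (stmt-AtomisticToContinuum-13440), line `registered`: the lead's stub
# `stub_coarsePosCore` — coarse occupation-law entropy bound for positive-core potentials

Support file (`--supports stmt-AtomisticToContinuum-13440`; registered stub of the reshaped skeleton `Lines/birth.lean`).
For a repulsive finite-range `v` with `v ≥ c > 0` on `(0, r₀]` (hard cores `c = ⊤` included), at density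
`ρ < ρ_E` (`EnergyPerParticleBound`: `E₀ ≤ K N` eventually), with cell side `l = r₀/2`, `M = ⌈L/l⌉₊`, `s = L/M`:
every `Ψ` with `energy ≤ E₀ + 1` has `Σ_k M⁻³ klFun(M³ P_k) ≤ 8(1 + 2(max K 0 + 1)/c₁)/(ρ l³) + 1`,
`c₁ = (min c 1).toReal`, uniformly in `N = n+1 ≥ ρ l³`. The interaction alone pays for clumping:
`energy ≥ c₁ E[#ordered pairs sharing a cell]/2`, so `(n+1)²Σ_k P_k² ≤ (n+1) + 2·energy/c₁`
(`…PosCoreOccupation.lean`), and `klFun x ≤ (x−1)²`, `M³ ≤ 8(n+1)/(ρl³)`. No Lieb–Yngvason input is used.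
-/

noncomputable section

namespace Summit.AtomisticToContinuum.BoseEinsteinCondensation.Cruxes.OneBodyEntropyBound.Birth

open MeasureTheory Set Filter InformationTheory
open scoped ENNReal
open Literature.MathematicalPhysics.QuantumManyBody.BoseGas
open Summit.AtomisticToContinuum.BoseEinsteinCondensation.Theorems

/-! ### The stub -/

open PosCore in
/-- **Registered stub `stub_coarsePosCore`** (crux stmt-AtomisticToContinuum-13440, line `registered`): for a
repulsive finite-range pair potential with a POSITIVE CORE (`v ≥ c > 0` on `(0, r₀]`), at the fixed cell side
`l = r₀/2`, the cell-occupation law of one boson of every `1`-near-minimiser is within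
`C = 8(1 + 2(max K 0 + 1)/c₁)/(ρ l³) + 1` (`c₁ = min c 1`) of uniform: `Σ_k M⁻³ klFun(M³P_k) ≤ C` for all large
`N`. Proof: `klFun x ≤ (x−1)²` gives `Σ_k M⁻³klFun(M³P_k) ≤ M³Σ_kP_k² + 1`; the pigeonhole bound on the interaction
and Jensen give `(n+1)²Σ_kP_k² ≤ (n+1) + 2·energy/c₁`; `energy ≤ E₀ + 1 ≤ K(n+1) + 1`
(`energyPerParticleBound_proof`) and `M³ ≤ 8(n+1)/(ρ l³)`. [folklore] -/
theorem stub_coarsePosCore :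
    ∀ v : ℝ → ENNReal,
      Literature.MathematicalPhysics.QuantumManyBody.BoseGas.IsRepulsiveFiniteRange v →
      (∃ c : ENNReal, ∃ r₀ : ℝ, 0 < c ∧ 0 < r₀ ∧ ∀ r : ℝ, 0 < r → r ≤ r₀ → c ≤ v r) →
      ∃ ρ₀ : ℝ, 0
      < ρ₀ ∧ ∀ ρ : ℝ, 0 < ρ → ρ < ρ₀ → ∃ l : ℝ, 0 < l ∧ ∃ C : ℝ, ∀ᶠ n : ℕ in Filter.atTop, ∃ δ :
      ENNReal, 0 < δ ∧ ∀ Ψ : Literature.MathematicalPhysics.QuantumManyBody.BoseGas.TrialState (n +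
      1) (Literature.MathematicalPhysics.QuantumManyBody.BoseGas.sideLength ρ (n + 1)),
      Literature.MathematicalPhysics.QuantumManyBody.BoseGas.energy v Ψ ≤
      Literature.MathematicalPhysics.QuantumManyBody.BoseGas.groundStateEnergy v (n + 1)
      (Literature.MathematicalPhysics.QuantumManyBody.BoseGas.sideLength ρ (n + 1)) + δ →
      ENNReal.ofReal (∑ k : Fin 3 → Fin
      ⌈Literature.MathematicalPhysics.QuantumManyBody.BoseGas.sideLength ρ (n + 1) / l⌉₊,
      ((⌈Literature.MathematicalPhysics.QuantumManyBody.BoseGas.sideLength ρ (n + 1) / l⌉₊ : ℝ) ^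
      3)⁻¹ * InformationTheory.klFun
      ((⌈Literature.MathematicalPhysics.QuantumManyBody.BoseGas.sideLength ρ (n + 1) / l⌉₊ : ℝ) ^ 3
      * (∫ x in {y : EuclideanSpace ℝ (Fin 3) | ∀ j, y j ∈ Set.Ico (((k j : ℕ) : ℝ) *
      ((Literature.MathematicalPhysics.QuantumManyBody.BoseGas.sideLength ρ (n + 1)) /
      (⌈Literature.MathematicalPhysics.QuantumManyBody.BoseGas.sideLength ρ (n + 1) / l⌉₊ : ℝ)))
      ((((k j : ℕ) : ℝ) + 1) * ((Literature.MathematicalPhysics.QuantumManyBody.BoseGas.sideLength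
      ρ (n + 1)) / (⌈Literature.MathematicalPhysics.QuantumManyBody.BoseGas.sideLength ρ (n + 1) /
      l⌉₊ : ℝ)))}, ∫ Y' : Literature.MathematicalPhysics.QuantumManyBody.BoseGas.Config n, ‖Ψ.ψ
      (Matrix.vecCons x Y')‖ ^ 2))) ≤ ENNReal.ofReal C := by
  intro v hv hcore
  obtain ⟨c, r₀, hc, hr₀, hvc⟩ := hcore
  obtain ⟨ρE, hρE, hK⟩ :=
    Summit.AtomisticToContinuum.BoseEinsteinCondensation.Theorems.energyPerParticleBound_proof v hv
  refine ⟨ρE, hρE, fun ρ hρ hρlt => ?_⟩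
  obtain ⟨K, hKev⟩ := hK ρ hρ hρlt
  -- the core constant `c₁ = min c 1 ∈ (0, 1]`
  set c₁ : ℝ≥0∞ := min c 1 with hc₁def
  have hc₁pos : 0 < c₁ := lt_min hc one_pos
  have hc₁0 : c₁ ≠ 0 := hc₁pos.ne'
  have hc₁top : c₁ ≠ ⊤ := ne_top_of_le_ne_top ENNReal.one_ne_top (min_le_right _ _)
  have hc₁v : ∀ r : ℝ, 0 < r → r ≤ r₀ → c₁ ≤ v r := fun r hr hrr => (min_le_left _ _).trans (hvc r hr hrr)
  have hcr : 0 < c₁.toReal := ENNReal.toReal_pos hc₁0 hc₁top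
  -- the {y : Space | ∀ j, y j ∈ Set.Ico (((and j : ℕ) : ℝ) * side) ((((and j : ℕ) : ℝ) + 1) * side)} the constant
  set l : ℝ := r₀ / 2 with hldef
  have hl : 0 < l := by positivity
  set K₁ : ℝ := max K 0 + 1 with hK₁def
  have hK₁ : 0 < K₁ := by positivity
  refine ⟨l, hl, 8 * (1 + 2 * K₁ / c₁.toReal) / (ρ * l ^ 3) + 1, ?_⟩
  have hK' : ∀ᶠ n : ℕ in atTop, groundStateEnergy v (n + 1) (sideLength ρ (n + 1)) ≤
      ENNReal.ofReal (K * ((n + 1 : ℕ) : ℝ)) := (tendsto_add_atTop_nat 1).eventually hKev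
  filter_upwards [hK', eventually_ge_atTop ⌈ρ * l ^ 3⌉₊] with n hKn hn
  -- geometry: `L`, `M`, `s`
  set L := sideLength ρ (n + 1) with hLdef
  have hNpos : (0 : ℝ) < ((n + 1 : ℕ) : ℝ) := by exact_mod_cast Nat.succ_pos n
  have hN1 : (1 : ℝ) ≤ ((n + 1 : ℕ) : ℝ) := by exact_mod_cast Nat.succ_pos n
  have hL : 0 < L := Real.rpow_pos_of_pos (div_pos hNpos hρ) _
  have hL3 : L ^ 3 = ((n + 1 : ℕ) : ℝ) / ρ := by
    have h := div_sideLength_pow_three hρ (Nat.succ_pos n)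
    rw [← hLdef, div_eq_iff (pow_pos hL 3).ne'] at h
    rw [eq_div_iff hρ.ne', h, mul_comm]
  have hNρ : ρ * l ^ 3 ≤ ((n + 1 : ℕ) : ℝ) := by
    have h1 : ρ * l ^ 3 ≤ (⌈ρ * l ^ 3⌉₊ : ℝ) := Nat.le_ceil _
    have h2 : ((⌈ρ * l ^ 3⌉₊ : ℕ) : ℝ) ≤ (n : ℝ) := by exact_mod_cast hn
    push_cast
    linarith
  have hlL : l ≤ L := by
    by_contra hlt
    have h3 : L ^ 3 < l ^ 3 := pow_lt_pow_left₀ (not_le.1 hlt) hL.le three_ne_zero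
    rw [hL3, div_lt_iff₀ hρ] at h3
    linarith
  set M := ⌈L / l⌉₊ with hMdef
  have hM : 1 ≤ M := Nat.one_le_iff_ne_zero.2 (Nat.ceil_pos.2 (div_pos hL hl)).ne'
  have hMpos : (0 : ℝ) < M := by exact_mod_cast hM
  have hMle : (M : ℝ) ≤ 2 * L / l := by
    have h1 : (M : ℝ) < L / l + 1 := Nat.ceil_lt_add_one (div_nonneg hL.le hl.le)
    have h2 : 1 ≤ L / l := by rwa [le_div_iff₀ hl, one_mul]
    have h3 : 2 * L / l = L / l + L / l := by ring
    linarith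
  have hM3 : (M : ℝ) ^ 3 ≤ 8 * ((n + 1 : ℕ) : ℝ) / (ρ * l ^ 3) := by
    calc (M : ℝ) ^ 3 ≤ (2 * L / l) ^ 3 := pow_le_pow_left₀ hMpos.le hMle 3
      _ = 8 * L ^ 3 / l ^ 3 := by rw [div_pow, mul_pow]; norm_num
      _ = 8 * ((n + 1 : ℕ) : ℝ) / (ρ * l ^ 3) := by rw [hL3]; field_simp
  set s : ℝ := L / M with hsdef
  have hs : 0 < s := div_pos hL hMpos
  have hsl : s ≤ l := by
    rw [hsdef, div_le_iff₀ hMpos]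
    have h := Nat.le_ceil (L / l)
    rw [div_le_iff₀ hl] at h
    linarith
  have hsr : 3 * s ^ 2 ≤ r₀ ^ 2 := by
    have h1 : s ≤ r₀ / 2 := hsl
    have h2 : s ^ 2 ≤ (r₀ / 2) ^ 2 := pow_le_pow_left₀ hs.le h1 2
    nlinarith
  refine ⟨1, one_pos, fun Ψ hΨE => ?_⟩
  -- the energy of a near-minimiser is finite and `≤ K₁ (n+1)`
  have hEle : energy v Ψ ≤ ENNReal.ofReal (K₁ * ((n + 1 : ℕ) : ℝ)) := by
    calc energy v Ψ ≤ groundStateEnergy v (n + 1) L + 1 := hΨE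
      _ ≤ ENNReal.ofReal (K * ((n + 1 : ℕ) : ℝ)) + 1 := add_le_add hKn le_rfl
      _ ≤ ENNReal.ofReal (max K 0 * ((n + 1 : ℕ) : ℝ)) + ENNReal.ofReal (1 * ((n + 1 : ℕ) : ℝ)) := by
          gcongr
          · exact le_max_left _ _
          · rw [← ENNReal.ofReal_one]; exact ENNReal.ofReal_le_ofReal (by nlinarith)
      _ = ENNReal.ofReal (K₁ * ((n + 1 : ℕ) : ℝ)) := by
          rw [← ENNReal.ofReal_add (by positivity) (by positivity), hK₁def]; ring_nf
  have hEtop : energy v Ψ ≠ ⊤ := ne_top_of_le_ne_top ENNReal.ofReal_ne_top hEle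
  have hEreal : (energy v Ψ).toReal ≤ K₁ * ((n + 1 : ℕ) : ℝ) := by
    have := ENNReal.toReal_mono ENNReal.ofReal_ne_top hEle
    rwa [ENNReal.toReal_ofReal (by positivity)] at this
  -- the {y : Space | ∀ j, y j ∈ Set.Ico (((and j : ℕ) : ℝ) * masses) ((((and j : ℕ) : ℝ) + 1) * masses)} the occupation bound
  set P : (Fin 3 → Fin M) → ℝ := fun k =>
    ∫ x in {y : Space | ∀ j, y j ∈ Set.Ico (((k j : ℕ) : ℝ) * s) ((((k j : ℕ) : ℝ) + 1) * s)}, ∫ Y : Config n, ‖Ψ.ψ (Matrix.vecCons x Y)‖ ^ 2 with hPdef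
  have hP0 : ∀ k, 0 ≤ P k := fun k => integral_nonneg fun x => integral_nonneg fun Y => sq_nonneg _
  have hocc : ((n + 1 : ℕ) : ℝ) ^ 2 * ∑ k, P k ^ 2 ≤ ((n + 1 : ℕ) : ℝ) + 2 * (energy v Ψ).toReal / c₁.toReal :=
    sq_mul_sum_sq_cellMass_le hr₀.le hs hsr hc₁v hc₁0 hc₁top Ψ hEtop
  have hsumsq : ∑ k, P k ^ 2 ≤ (1 + 2 * K₁ / c₁.toReal) / ((n + 1 : ℕ) : ℝ) := by
    rw [le_div_iff₀ hNpos]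
    have h1 : ((n + 1 : ℕ) : ℝ) ^ 2 * ∑ k, P k ^ 2 ≤
        ((n + 1 : ℕ) : ℝ) * (1 + 2 * K₁ / c₁.toReal) := by
      calc ((n + 1 : ℕ) : ℝ) ^ 2 * ∑ k, P k ^ 2 ≤ ((n + 1 : ℕ) : ℝ) + 2 * (energy v Ψ).toReal / c₁.toReal :=
            hocc
        _ ≤ ((n + 1 : ℕ) : ℝ) + 2 * (K₁ * ((n + 1 : ℕ) : ℝ)) / c₁.toReal := by
            gcongr
        _ = ((n + 1 : ℕ) : ℝ) * (1 + 2 * K₁ / c₁.toReal) := by field_simp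
    have h2 : ((n + 1 : ℕ) : ℝ) ^ 2 * ∑ k, P k ^ 2 = ((n + 1 : ℕ) : ℝ) * ((∑ k, P k ^ 2) * ((n + 1 : ℕ) : ℝ)) := by
      ring
    rw [h2] at h1
    exact le_of_mul_le_mul_left h1 hNpos
  -- `klFun x ≤ (x-1)²` termwise
  have hkl : ∑ k, ((M : ℝ) ^ 3)⁻¹ * klFun ((M : ℝ) ^ 3 * P k) ≤ (M : ℝ) ^ 3 * ∑ k, P k ^ 2 + 1 := by
    have hM3pos : (0 : ℝ) < (M : ℝ) ^ 3 := by positivity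
    have hterm : ∀ k, ((M : ℝ) ^ 3)⁻¹ * klFun ((M : ℝ) ^ 3 * P k) ≤
        (M : ℝ) ^ 3 * P k ^ 2 + ((M : ℝ) ^ 3)⁻¹ := by
      intro k
      have h := klFun_le_sq_sub_one (mul_nonneg hM3pos.le (hP0 k))
      calc ((M : ℝ) ^ 3)⁻¹ * klFun ((M : ℝ) ^ 3 * P k) ≤ ((M : ℝ) ^ 3)⁻¹ * ((M : ℝ) ^ 3 * P k - 1) ^ 2 :=
            mul_le_mul_of_nonneg_left h (inv_nonneg.2 hM3pos.le)
        _ = (M : ℝ) ^ 3 * P k ^ 2 - 2 * P k + ((M : ℝ) ^ 3)⁻¹ := by field_simp; ring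
        _ ≤ (M : ℝ) ^ 3 * P k ^ 2 + ((M : ℝ) ^ 3)⁻¹ := by linarith [hP0 k]
    have hcard : ∑ _k : Fin 3 → Fin M, ((M : ℝ) ^ 3)⁻¹ = 1 := by
      rw [Finset.sum_const, Finset.card_univ, Fintype.card_fun, Fintype.card_fin, Fintype.card_fin,
        nsmul_eq_mul]
      push_cast
      field_simp
    calc ∑ k, ((M : ℝ) ^ 3)⁻¹ * klFun ((M : ℝ) ^ 3 * P k)
        ≤ ∑ k, ((M : ℝ) ^ 3 * P k ^ 2 + ((M : ℝ) ^ 3)⁻¹) := Finset.sum_le_sum fun k _ => hterm k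
      _ = (M : ℝ) ^ 3 * ∑ k, P k ^ 2 + 1 := by rw [Finset.sum_add_distrib, hcard, Finset.mul_sum]
  -- conclude
  change ENNReal.ofReal (∑ k : Fin 3 → Fin M, ((M : ℝ) ^ 3)⁻¹ * klFun ((M : ℝ) ^ 3 * P k)) ≤ _
  refine ENNReal.ofReal_le_ofReal (hkl.trans ?_)
  have hfin : (M : ℝ) ^ 3 * ∑ k, P k ^ 2 ≤ 8 * (1 + 2 * K₁ / c₁.toReal) / (ρ * l ^ 3) := by
    calc (M : ℝ) ^ 3 * ∑ k, P k ^ 2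
        ≤ (8 * ((n + 1 : ℕ) : ℝ) / (ρ * l ^ 3)) * ((1 + 2 * K₁ / c₁.toReal) / ((n + 1 : ℕ) : ℝ)) :=
          mul_le_mul hM3 hsumsq (Finset.sum_nonneg fun k _ => sq_nonneg _) (by positivity)
      _ = 8 * (1 + 2 * K₁ / c₁.toReal) / (ρ * l ^ 3) := by field_simp
  linarith

end Summit.AtomisticToContinuum.BoseEinsteinCondensation.Cruxes.OneBodyEntropyBound.Birth

end
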